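import Summits.ABC.IUTFork.Conditional.AbcOfS
import Summits.ABC.IUTFork.Charitable.Thm311D3Derive
import HarnessLib

/-!
# Block D × branch C junction, team D3: the C certificate `abc_of_S_v2` with its [S] binder DISCHARGED by `Thm311Charitable_3`

Proof-only file (D-0012) of the abc-iut cell, block D (maximally-charitable re-typings of [IUTchIII] Thm. 3.11), team D3, seat
abc-iut-D3-typ (typer/anchor, gen 3); rung LADDER-ABC:A2.D (junction with A2.C). TAKES NO SIDE on [IUTchIII] Cor. 3.12. NO definition,
NO `Prop` fact. ONE theorem, purely compositional over two LANDED files: abc-iut-C-cert-1's branch-C certificate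
`Summit.ABC.IUTFork.Conditional.abc_of_S_v2` (Conditional/AbcOfS.lean: `ABC` from, per genuine Θ-volume datum, the single named
proposition S = `Cor312Vol.PilotKummerIndRelated` + the Corollary's two region pins + `BridgeHyps` + [IUTchIII] Thm. 3.11 (ii)(b) at the
setting's column + the campaign-S hull-volume node + the two READ equations) and team D3's block-D derivation
`Summit.ABC.IUTFork.Charitable.D3Derive.s_of_charitable_3_without_pins` (Charitable/Thm311D3Derive.lean, abc-iut-D3-prv p431653: S from
team D3's maximally-charitable Theorem 3.11 `Thm311Charitable_3`, abc-iut-D3-typ p431029, for EVERY region operator and with NO pin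
consumed). It is the team-D3 twin of abc-iut-D4-prv's `D4Derive.abc_of_charitable_4` (Charitable/Thm311D4AbcOfCharitable.lean), so that
the §L fold can cite one junction theorem per charitable reading. S. Mochizuki, *Inter-universal Teichmüller theory III/IV* (kurims,
May 2020); [claim: Mochizuki2012, status: disputed].

WHAT THE THEOREM SAYS — and what it does NOT. `abc_of_charitable_3` is `abc_of_S_v2` with the hypothesis [S] REPLACED by [CHAR] =
«team D3's charitable Theorem 3.11 `Thm311Charitable_3 (F P l T) (P312 P l T) (ρ P l T) (qK P l T)` holds at every datum's typed lattice
situation, setting, region reading and q-datum» and the C312 cone binder `hKumB` ((ii)(b) at column `n`) ABSORBED (frozen (ii) is the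
`partII` conjunct of the reading's clauses); every other binder of the C certificate is carried VERBATIM ([PIN] two region pins at `qK` +
`BridgeHyps`; [CONE] the hull-volume estimate `hvol` at the genuine data; [READ] `hΘ`, `hq`). Explicit `Prop` binders: CHAR 1 · PIN 2 ·
FACT 0 · CONE 1 · READ 2 = 6 (v2: 7, with S 1 and CONE 2). So, IN KERNEL and ONLY in this conditional sense: «`ABC` follows from the
maximally-charitable reading of [IUTchIII] Thm. 3.11 (team D3) + the Corollary's pins + the bridge hypotheses + the campaign-S hull-volume
node + the two reading equations, as typed». This is NOT a proof of abc and NOT an endorsement of the charitable reading — whose two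
load-bearing identification clauses `D3.IPL` (q-half) / `D3.EvalLinkCompat` the typer flagged «MAXIMAL», which are FALSE at every honest
pin-respecting carrier (`D3cx.not_thm311Charitable_3_naive`, `D3Derive.not_charitable_3_pinnedSetting`, `D3Real.not_charitable_3_settingPrVolSharp_of_pinned`)
and which the block-D referees grade STRONGER-THAN-PRINT (D-ref-2, 2026-08-26T09:16:57Z) — and takes no side between authors;
typed ≠ proved; locates / conditionally verifies; no abc claim.
-/

noncomputable section

namespace Summit.ABC.IUTFork.Charitable.D3Derive

open Thm311 Cor312 Cor312Vol Literature.IUT.LogThetaLattice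

open Literature.IUT.LogVolume Literature.NumberTheory.DiophantineGeometry.GenEll Summit.ABC.ABC.Theorems in
/-- **`abc_of_charitable_3` — branch C's certificate `abc_of_S_v2` with [S] discharged by team D3's charitable Theorem 3.11.** Per
`λ`-line point `P`, prime `l` and genuine Θ-volume datum `T` (DATA: the typed lattice situation `F P l T`, the Cor.-3.12 setting
`P312 P l T`, the region reading `ρ P l T`, the q-datum `qK P l T`), the explicit hypotheses are: [CHAR] `hChar` =
`Thm311Charitable_3 (F P l T) (P312 P l T) (ρ P l T) (qK P l T)` at every datum · [PIN] `hPin` = the two region pins (pΘ)(pq′) for `qK`,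
`hBridge` = `BridgeHyps` · [CONE] `hvol` = the hull-volume estimate at the genuine data (campaign S) · [READ] `hΘ`, `hq`. Route:
`D3Derive.s_of_charitable_3_without_pins` supplies [S] (route R1 = (IPL) ∧ (SHE) ∧ the q-datum interpretation; no pin, no frozen clause)
and the reading's own frozen `partII` conjunct supplies (ii)(b) at column `n` to `Conditional.abc_of_S_v2`, verbatim otherwise.
CONDITIONAL; no side taken on [IUTchIII] Cor. 3.12; whether the consumed clauses are print's is the D referees' question (graded
STRONGER-THAN-PRINT by D-ref-2). [claim: Mochizuki2012, status: disputed] -/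
theorem abc_of_charitable_3
    -- DATA (uncounted)
    {TI : ∀ (P : NFPoint) (l : ℕ), Cor22.ThetaVolumeDatumAt P l → ThetaIndex}
    (F : ∀ (P : NFPoint) (l : ℕ) (T : Cor22.ThetaVolumeDatumAt P l), LatticeSituation (TI P l T))
    (P312 : ∀ (P : NFPoint) (l : ℕ) (T : Cor22.ThetaVolumeDatumAt P l), Cor312.Setting (F P l T).toSituation)
    (ρ : ∀ (P : NFPoint) (l : ℕ) (T : Cor22.ThetaVolumeDatumAt P l),
      (∀ v : (TI P l T).V, v ∈ (TI P l T).Vbad → Set ((F P l T).L.StarPacket v)) →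
        ∀ (j : (TI P l T).Label) (vQ : (TI P l T).VQ), Set ((F P l T).L.Packet j vQ))
    (qK : ∀ (P : NFPoint) (l : ℕ) (T : Cor22.ThetaVolumeDatumAt P l),
      ∀ v : (TI P l T).V, v ∈ (TI P l T).Vbad → Set ((F P l T).L.StarPacket v))
    -- [CHAR] team D3's maximally-charitable Theorem 3.11 at every datum
    (hChar : ∀ P l T, Summit.ABC.IUTFork.Charitable.Thm311Charitable_3 (F P l T) (P312 P l T) (ρ P l T) (qK P l T))
    -- [PIN] the Corollary's two region pins for the q-datum `qK`, and the bridge hypotheses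
    (hPin : ∀ P l T, Cor312Vol.PinnedRegions (F P l T) (P312 P l T) (ρ P l T) (qK P l T))
    (hBridge : ∀ P l T, Cor312Vol.BridgeHyps (P312 P l T))
    -- [FACT] (none)
    -- [CONE] (ii′) the hull-volume estimate at the genuine data (campaign S); (ii)(b) is inside [CHAR]
    (hvol : ∀ P : NFPoint, P ∈ UP → ∀ l : ℕ, l.Prime → 5 ≤ l →
      Cor22.AdmitsCore P → Cor22.CondP2 P l → Cor22.CondP5 P l → Cor22.CondP6 P l →
        Cor22.HullVolumeAtDatum P l (((l : ℝ) + 1) / 4 *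
          ((1 + 12 * (Cor22.dmod P : ℝ) / l) * (P.logDiff + Cor22.logCondAvoid P {2, l})
            + 2 * Real.log l + 52
            + 20 / 3 * Real.log (((2 ^ 12 * 3 ^ 3 * 5 * Cor22.dmod P : ℕ) : ℝ) * (l : ℝ))
              * (Nat.primeCounting (2 ^ 12 * 3 ^ 3 * 5 * Cor22.dmod P * l) : ℝ))))
    -- [READ] the setting's two numbers are the datum's defined numbers
    (hΘ : ∀ P l T (x : ℝ), (P312 P l T).negLogTheta = (x : WithTop ℝ) → T.negLogTheta = x)
    (hq : ∀ P l T, (P312 P l T).negLogQ = T.negAbsLogQ) :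
    _root_.ABC :=
  Conditional.abc_of_S_v2 F P312 ρ qK
    (fun P l T => s_of_charitable_3_without_pins (F P l T) (P312 P l T) (ρ P l T) (qK P l T) (hChar P l T))
    hPin hBridge
    (fun P l T => by
      obtain ⟨X, hX⟩ := hChar P l T
      exact (hX.partII (P312 P l T).n).2.1)
    hvol hΘ hq

end Summit.ABC.IUTFork.Charitable.D3Derive

end
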